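/-
Copyright (c) 2026 the pub-hodgecm-mathlib formalisation cell (harness21).  Prover seat hodgecm-mathlib-B-p04 (g30), floor 0, programme P5
(Alb-CM), row R2′-G1 (desk F0P5-plan (g4), 2026-08-31).  KERNEL module: THEOREMS ONLY (no definition, no named fact, no `sorry`, no instance,
no notation).
-/
import Summits.HodgeConjecture.HodgeConjecture.Theorems.F0P5CurveThetaCompanionDetTwist
import Literature.RepresentationTheory.Liu2021.OscillatorConventions
import HarnessLib

/-!
# F0 · P5 pay-down line `Cruxes/HLiu418/Lines/F0_P5_CurveThetaLettersPaydown` (ED. 3), stub R2G `CompanionDetTwist₂`: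
# §2–§5 — the companion relabel `λ ↦ λ′ = λᶜ·χ̌` IS a determinant twist of the finite Weil carrier ([Liu2021, Lem. D.1 (4)]), PROVED

Cell `hodgecm-mathlib`, floor 0, programme P5 (Alb-CM); crux item `stmt-HodgeConjecture-24832`
(`Summit.HodgeConjecture.HodgeConjecture.Theses.HCCMUnconditional.HLiu418`).  Sequel of ★ §1 (`F0P5CurveThetaCompanionDetTwist`, p828480:
the det-twist character `α(u) = Λ(u)⁻¹·χ(u_f)` — continuity, automorphy, unitarity, and (T1) `Λᶜ·χ̌ = Λ·α̃`).  This file closes the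
registered stub R2G of the line BY NAME-SHAPE: the head `stub_sl_companionDetTwist_holds` has as its type the body of
`def CompanionDetTwist₂` (ED. 3, tree sha16 8b8f2d0be470dd08, :272) VERBATIM (Theorems never import Lines; the registrar folds
`stub_sl_companionDetTwist := stub_sl_companionDetTwist_holds` in the next edition).

MATHEMATICS ([GelbartRogawski1991, §3.1 Remark p. 457]: the compatible splittings form a torsor under the automorphic characters of
`G₁(𝔸) = U(J_V ⊗ J_W)(𝔸)`; [Liu2021, App. D §D.1 Step 2]: `ω(μ, ε, χ)` restricts along the splitting `ι_μ`).  For a label `λ′` with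
`Λ′ = Λᶜ·χ̌` (`Λ := toHeckeCharacter λ`):
* (T1)+(T2) `Λ′ = Λ·α̃` (★ §1) and ★ `chiSplittingLine_mul_ratioHecke` (`ι_{Λ·α̃} = ι_Λ ⊗ (α ∘ det)`) give, after the proof-irrelevant
  congruence `chiSplittingLine_congr`, the EQUALITY of pair splittings `s[λ′]_a = s[λ]_a ⊗ (α ∘ pairDet)` at every line `⟨a⟩` (§2, §5);
* (T3) transport of the `χ_W`-coinvariants of the finite Weil representation along an equality of splittings (`exists_coinvEquiv_of_splitting_eq`,
  `subst`: the carrier `finPairRepW hs` depends on the splitting only through the type of the compatibility proof) (§3);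
* (T4) ★ `weilCoinvTwistEquiv` / `weilCoinvTwistEquiv_weilCoinv` (`Ω(s ⊗ ĉ, ĉ_W·χ) ≅ ĉ_V ⊗ Ω(s, χ)`, `mk f ↦ mk f`) with the determinant
  plumbing of §4: `ĉ_V(k) = α(det k)` (`twistCharV_comp_pairDet`: `det (k ⊗ 1₁) = det k`) and `ĉ_W(u·1_W) = α((1,u))²` on the line
  (`twistCharW_comp_pairDet_finAdelicCenter`: the two finite-adelic centres coincide in `G₁`, ★ `adelicInl_finAdelicCenter_eq_adelicInr_finAdelicCenter`,
  and `det (u·1_V) = u^2`) — which is exactly where the hypothesis `χf = χ · (α_f²)⁻¹` (`χ♭`) of the stub enters;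
* (T5) = the head: `T := T₃ ≫ E` and the displayed action law `T ∘ ρ[λ′](k) = α(det k) • Ω[λ](χ♭)(k) ∘ T`.

HONEST LABEL: HC_CM is proved only modulo the printed citations — the 2 remaining named inputs (hLiu418, h413) — until rung 0 closes; this file
proves ONE registered support stub (R2G) of ONE floor-0 pay-down line of the hLiu418 binder and discharges no letter by itself (R2′ also needs R2″,
typer-first).  Recon memo: `F0/P5/B-p08/g21/R2prime-routeG-recon.B-p08g21.md` §2.2–§2.4.

## References
* [Liu2021] Y. Liu, *Fourier–Jacobi cycles and arithmetic relative trace formula*, Camb. J. Math. 9 (2021) = arXiv:2102.11518: Def. 4.11 (l. 2083–2097),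
  App. D §D.1 Steps 1–3 (l. 5214–5221), Lem. D.1 (4) (p. 126, l. 5235), Rem. 4.4.
* [GelbartRogawski1991] S. Gelbart, J. Rogawski, *L-functions and Fourier–Jacobi coefficients for the unitary group U(3)*, Invent. Math. 105 (1991),
  §3.1 Prop. 3.1.1 p. 455, Remark p. 457 L4–13.
* [HarrisKudlaSweet1996] M. Harris, S. Kudla, W. J. Sweet, *Theta dichotomy for unitary groups*, J. AMS 9 (1996), §1 (1.14)–(1.15).
* [Mok2014] C. P. Mok, Mem. AMS 235 (2015), §1 Notation p. 5 (`U(1)` = centre of `U(N)`, `det`).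
-/

set_option autoImplicit false
set_option linter.dupNamespace false

noncomputable section

open NumberField NumberField.InfinitePlace IsDedekindDomain
open scoped Matrix Kronecker ComplexOrder
open Literature.NumberTheory.Automorphic Literature.NumberTheory.Automorphic.UnitaryGroup
open Literature.NumberTheory.Automorphic.Liu2021 Literature.NumberTheory.Automorphic.Liu2021.Def411WeilCarriers
open Literature.NumberTheory.Automorphic.Liu2021.Def411WeilCarriersDoubling
open Literature.NumberTheory.GaloisRepresentations Literature.NumberTheory.Automorphic.IdeleClassGroup
open Literature.NumberTheory.ComplexMultiplication (CMTypeOps.bar)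
open Literature.NumberTheory.GelbartRogawski1991 Literature.NumberTheory.GelbartRogawski1991.UnitaryDualPair
open Literature.NumberTheory.GelbartRogawski1991.UnitaryDualPair.WeilCoinv
open Literature.NumberTheory.GelbartRogawski1991.GRConstruction.DoubledWeilDetTwist
open Literature.NumberTheory.Weil1964
open Literature.RepresentationTheory (TwistedCoinv.Coinv TwistedCoinv.mk)
open Literature.RepresentationTheory.Liu2021 Literature.RepresentationTheory.HarrisKudlaSweet1996

namespace Summit.HodgeConjecture.HodgeConjecture.Cruxes.HLiu418.F0P5CurveThetaCompanionDetTwist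

/-! ## §2 Congruence of the splitting attached to `χ` in the Hecke-character argument -/

section Congr

variable (L : Type) [Field L] [NumberField L] [IsCMField L]
  {N' n' : ℕ} (e₁ : Fin N' × Fin 1 ≃ Fin n')
  (dV₁ : Fin N' → L) (hdV₁ : ∀ i, IsCMField.complexConj L (dV₁ i) = dV₁ i) (hdV₁0 : ∀ i, dV₁ i ≠ 0)

/-- **`ι_{Λ₁} = ι_{Λ₂}` for `Λ₁ = Λ₂`** — the splitting attached to a Hecke character at the line `⟨T_W⟩` does not depend on the proofs
of unitarity ∕ of the splitting condition it is handed (`subst; rfl`). [cite: Liu2021, App. D §D.1 Step 2 (l. 5219)] -/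
theorem chiSplittingLine_congr {Λ₁ Λ₂ : HeckeCharacter L} (h : Λ₁ = Λ₂)
    (h₁u : Λ₁.IsUnitary) (h₁s : IsSplittingChar L 1 Λ₁) (h₂u : Λ₂.IsUnitary) (h₂s : IsSplittingChar L 1 Λ₂)
    (TW : Matrix (Fin 1) (Fin 1) ↥(maximalRealSubfield L)) (hWd : IsUnit TW.det) (JW : Matrix (Fin 1) (Fin 1) L)
    (hJW : JW = TW.map (algebraMap (↥(maximalRealSubfield L)) L)) :
    chiSplittingLine L e₁ dV₁ hdV₁ hdV₁0 Λ₁ h₁u h₁s TW hWd JW hJW = chiSplittingLine L e₁ dV₁ hdV₁ hdV₁0 Λ₂ h₂u h₂s TW hWd JW hJW := by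
  subst h
  rfl

end Congr

/-! ## §3 Transport of the Weil `χ_W`-coinvariants along an equality of pair splittings -/

section Transport

variable (F E : Type) [Field F] [NumberField F] [Field E] [NumberField E] [Algebra F E]
variable (c : E ≃ₐ[F] E) (N M : ℕ) {n : ℕ} (e : Fin N × Fin M ≃ Fin n)
variable (JV : Matrix (Fin N) (Fin N) E) (JW : Matrix (Fin M) (Fin M) E)
variable {TV : Matrix (Fin N) (Fin N) F} {TW : Matrix (Fin M) (Fin M) F}
variable [Algebra.IsQuadraticExtension F E] {δ : E} (hcδ : c δ = -δ) (hδ : δ ≠ 0) {d : F}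
  (hd : δ * δ = algebraMap F E d) (hV : TV.IsSymm) (hW : TW.IsSymm) (hVd : IsUnit TV.det) (hWd : IsUnit TW.det)
  (hJV : JV = TV.map (algebraMap F E)) (hJW : JW = TW.map (algebraMap F E))

/-- **Transport along equal splittings**: for `s₁ = s₂` (two names of one compatible pair splitting) the `χ_W`-coinvariants of the
finite Weil representation at `s₁` and at `s₂` are identified by the identity, `U(J_V)(𝔸_{F,f})`-equivariantly (`subst`: the carriers
depend on the splitting only through the TYPE of the compatibility proof). [cite: GelbartRogawski1991, §3.1 Prop. 3.1.1 p. 455] -/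
theorem exists_coinvEquiv_of_splitting_eq
    {s₁ s₂ : UnitaryGroup.adelicPair F E c N M JV JW →* adelicMpCont F (Fin n) (adelicGram F e TV TW)} (h : s₁ = s₂)
    (hs₁ : (splittingDatum F E c N M e JV JW hcδ hδ hd hV hW hVd hWd hJV hJW).IsCompatible s₁)
    (hs₂ : (splittingDatum F E c N M e JV JW hcδ hδ hd hV hW hVd hWd hJV hJW).IsCompatible s₂)
    (χW : UnitaryGroup.finAdelic F E c M JW →* ℂˣ) :
    ∃ T : TwistedCoinv.Coinv (finPairRepW F E c N M e JV JW hcδ hδ hd hV hW hVd hWd hJV hJW hs₁) χW ≃ₗ[ℂ]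
        TwistedCoinv.Coinv (finPairRepW F E c N M e JV JW hcδ hδ hd hV hW hVd hWd hJV hJW hs₂) χW,
      ∀ k x, T (weilCoinv F E c N M e JV JW hcδ hδ hd hV hW hVd hWd hJV hJW χW hs₁ k x) =
        weilCoinv F E c N M e JV JW hcδ hδ hd hV hW hVd hWd hJV hJW χW hs₂ k (T x) := by
  subst h
  exact ⟨LinearEquiv.refl ℂ _, fun _ _ => rfl⟩

end Transport

/-! ## §4 Determinant plumbing on the dual pair `U(J_V) × U(⟨a⟩)` (`M = 1`) -/

section Det

variable (F E : Type) [Field F] [NumberField F] [Field E] [NumberField E] [Algebra F E]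
variable (c : E ≃ₐ[F] E) (N : ℕ) {n : ℕ} (e : Fin N × Fin 1 ≃ Fin n)
variable (JV : Matrix (Fin N) (Fin N) E) (JW : Matrix (Fin 1) (Fin 1) E)

omit [NumberField F] in
/-- **`det (k ⊗ 1₁) = det k`**: on the `U(J_V)`-member of the pair with a LINE, `pairDet ∘ (· ⊗ 1) = det_V` in `U(1)(𝔸_F)`.
[cite: GelbartRogawski1991, §3.1 Remark p. 457 L9–13] [cite: Mok2014, §1 Notation p. 5] -/
theorem pairDet_adelicInl (hJ : (Matrix.reindex e e (JV ⊗ₖ JW)).det ≠ 0) (hJV : JV.det ≠ 0) (x : UnitaryGroup.adelic F E c N JV) :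
    pairDet F E c N 1 e JV JW hJ (UnitaryGroup.adelicInl F E c N 1 JV JW x) = UnitaryGroup.adelicDet F E c N JV hJV x := by
  apply Subtype.ext
  apply Units.ext
  rw [coe_coe_pairDet, UnitaryGroup.coe_coe_adelicDet, UnitaryGroup.coe_adelicInl, Matrix.det_kronecker, Matrix.det_one, one_pow,
    mul_one, Fintype.card_fin, pow_one]

/-- **the finite-adelic centre `(1, u·1_N)` of `U(J)(𝔸_F)` is the adelic centre at the idèle `(1, u)`.** [cite: Mok2014, §1 Notation p. 5] -/
theorem finCenterAdelic_eq_adelicCenter_finiteIdele (u : UnitaryGroup.finAdelicOne F E c) :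
    UnitaryGroup.finCenterAdelic F E c N JV u =
      UnitaryGroup.adelicCenter F E c N JV ⟨finiteIdele E (u : (FiniteAdeleRing (𝓞 E) E)ˣ), finiteIdele_mem_adelicOne F E c u⟩ := by
  apply Subtype.ext
  apply Units.ext
  rw [UnitaryGroup.coe_finCenterAdelic, UnitaryGroup.coe_adelicCenter]
  rfl

/-- **`det (1, u·1_N) = (1, u)^N`** in `U(1)(𝔸_F)`. [cite: Mok2014, §1 Notation p. 5] -/
theorem adelicDet_finCenterAdelic (hJV : JV.det ≠ 0) (u : UnitaryGroup.finAdelicOne F E c) :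
    UnitaryGroup.adelicDet F E c N JV hJV (UnitaryGroup.finCenterAdelic F E c N JV u) =
      ⟨finiteIdele E (u : (FiniteAdeleRing (𝓞 E) E)ˣ), finiteIdele_mem_adelicOne F E c u⟩ ^ N := by
  rw [finCenterAdelic_eq_adelicCenter_finiteIdele, UnitaryGroup.adelicDet_adelicCenter]

/-- **the `U(J_V)`-member of `α ∘ det`**: `(α ∘ pairDet)((1,k) ⊗ 1) = α(det (1,k))`. [cite: GelbartRogawski1991, §3.1 Remark p. 457 L9–13] -/
theorem twistCharV_comp_pairDet (hJ : (Matrix.reindex e e (JV ⊗ₖ JW)).det ≠ 0) (hJV : JV.det ≠ 0)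
    (α : UnitaryGroup.adelicOne F E c →* ℂˣ) (k : UnitaryGroup.finAdelic F E c N JV) :
    twistCharV F E c N 1 JV JW (α.comp (pairDet F E c N 1 e JV JW hJ)) k =
      α (UnitaryGroup.adelicDet F E c N JV hJV (UnitaryGroup.finAdelicToAdelic F E c N JV k)) := by
  rw [twistCharV_apply, MonoidHom.comp_apply, pairDet_adelicInl]

/-- **the `U(⟨a⟩)`-member of `α ∘ det` on the centre of the line**: `(α ∘ pairDet)(1 ⊗ (1, u·1_1)) = α((1,u))^N` — the two finite-adelic
centres coincide in `G₁` (★ `adelicInl_finAdelicCenter_eq_adelicInr_finAdelicCenter`) and `det (1, u·1_N) = (1,u)^N`.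
[cite: GelbartRogawski1991, §3.1 p. 454, Remark p. 457 L9–13] [cite: Mok2014, §1 Notation p. 5] -/
theorem twistCharW_comp_pairDet_finAdelicCenter (hJ : (Matrix.reindex e e (JV ⊗ₖ JW)).det ≠ 0) (hJV : JV.det ≠ 0)
    (α : UnitaryGroup.adelicOne F E c →* ℂˣ) (u : UnitaryGroup.finAdelicOne F E c) :
    twistCharW F E c N 1 JV JW (α.comp (pairDet F E c N 1 e JV JW hJ)) (UnitaryGroup.finAdelicCenter F E c 1 JW u) =
      α ⟨finiteIdele E (u : (FiniteAdeleRing (𝓞 E) E)ˣ), finiteIdele_mem_adelicOne F E c u⟩ ^ N := by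
  rw [twistCharW_apply, MonoidHom.comp_apply]
  change α (pairDet F E c N 1 e JV JW hJ (UnitaryGroup.adelicInr F E c N 1 JV JW (UnitaryGroup.finCenterAdelic F E c 1 JW u))) = _
  rw [← UnitaryGroup.adelicInl_finAdelicCenter_eq_adelicInr_finAdelicCenter, pairDet_adelicInl F E c N e JV JW hJ hJV,
    adelicDet_finCenterAdelic, map_pow]

end Det

/-! ## §5 The head: R2G `CompanionDetTwist₂` -/

set_option maxHeartbeats 2000000 in
-- (one pass through the `splittingDatum` ∕ `chiSplittingLine` telescopes of the registered statement, as in ★ `chiSplittingLine_mul_ratioHecke`)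
/-- **R2G `CompanionDetTwist₂` (ED. 3 of `Cruxes/HLiu418/Lines/F0_P5_CurveThetaLettersPaydown`, :272, body VERBATIM)** — for ANY label `λ′` with
`Λ′ = Λᶜ·χ̌` and the ∀-bound twist data `α(u) = Λ(u)⁻¹·χ(u_f)`, `χf = χ·(α_f²)⁻¹`, at every line `⟨a⟩`:
`ω_f(λ′, ε_a, χ) ≅ (α ∘ det_V) ⊗ Ω_f[λ](ε_a, χf)` as a linear equivalence `T` carrying the `λ′`-side `U(J_V)(𝔸_{L⁺,f})`-action to the `λ`-side action twisted
by `α(det k)`.  Proof: §2–§4 + ★ §1 (T1) + ★ `chiSplittingLine_mul_ratioHecke` + ★ `weilCoinvTwistEquiv(_weilCoinv)`.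
[cite: Liu2021, App. D Lem. D.1 (4) (p. 126); App. D §D.1 Step 2; Rem. 4.4] [cite: GelbartRogawski1991, Prop. 3.1.1, Remark p. 457] -/
theorem stub_sl_companionDetTwist_holds :
  ∀ (L : Type) [Field L] [NumberField L] [IsCMField L]
    (dV : Fin 2 → L) (hdV : ∀ i, IsCMField.complexConj L (dV i) = dV i) (hdV0 : ∀ i, dV i ≠ 0)
    (hJdet : (Matrix.diagonal dV).det ≠ 0)
    (hcc : IsCMField.complexConj L * IsCMField.complexConj L = 1)
    {n' : ℕ} (e₁ : Fin 2 × Fin 1 ≃ Fin n')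
    (lam : Literature.NumberTheory.Automorphic.IdeleClassGroup L →ₜ* Circle) (hlam : IsConjugateSymplectic L lam)
    (χ : Chi (↥(maximalRealSubfield L)) L (IsCMField.complexConj L))
    (lam' : Literature.NumberTheory.Automorphic.IdeleClassGroup L →ₜ* Circle) (hlam' : IsConjugateSymplectic L lam'),
    toHeckeCharacter L lam' =
      toHeckeCharacter L (IdeleClassGroup.galConj (IsCMField.complexConj L) lam) * HeckeCharacter.checkOfChi hcc χ →
    ∀ (α : UnitaryGroup.adelicOne (↥(maximalRealSubfield L)) L (IsCMField.complexConj L) →* ℂˣ),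
      (∀ u, α u = (toHeckeCharacter L lam (u : Literature.NumberTheory.GaloisRepresentations.ideleGroup L))⁻¹ *
          χ.1 ⟨finitePart L (u : Literature.NumberTheory.GaloisRepresentations.ideleGroup L), finitePart_mem_finAdelicOne (↥(maximalRealSubfield L)) L (IsCMField.complexConj L) u.2⟩) →
    ∀ (χf : UnitaryGroup.finAdelicOne (↥(maximalRealSubfield L)) L (IsCMField.complexConj L) →* ℂˣ),
      (∀ v, χf v = χ.1 v *
          (α ⟨finiteIdele L (v : (FiniteAdeleRing (𝓞 L) L)ˣ), finiteIdele_mem_adelicOne (↥(maximalRealSubfield L)) L (IsCMField.complexConj L) v⟩ ^ 2)⁻¹) →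
    ∀ a : (↥(maximalRealSubfield L))ˣ,
    ∃ T : omegaAtLine (↥(maximalRealSubfield L)) L (IsCMField.complexConj L) 2 e₁ (Matrix.diagonal dV)
            (complexConj_imagUnit L) (imagUnit_ne_zero L) (imagUnit_mul_self L) (realDiagonal_isSymm L dV hdV)
            (isUnit_det_realDiagonal L dV hdV hdV0) (realDiagonal_map L dV hdV).symm
            (fun a => isCompatible_chiSplittingLine L e₁ dV hdV hdV0 (toHeckeCharacter L lam') (isUnitary_toHeckeCharacter L lam')
              ((isOscillatorChar_toHeckeCharacter_iff lam').mpr hlam')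
              (TW (↥(maximalRealSubfield L)) a) (isSymm_TW (↥(maximalRealSubfield L)) a)
              (isUnit_det_TW (↥(maximalRealSubfield L)) a) (JW (↥(maximalRealSubfield L)) L a)
              (JW_eq (↥(maximalRealSubfield L)) L a)) a χ ≃ₗ[ℂ]
          TwistedCoinv.Coinv
            (finPairRepW (↥(maximalRealSubfield L)) L (IsCMField.complexConj L) 2 1 e₁ (Matrix.diagonal dV)
              (JW (↥(maximalRealSubfield L)) L a) (complexConj_imagUnit L) (imagUnit_ne_zero L) (imagUnit_mul_self L)
              (realDiagonal_isSymm L dV hdV) (isSymm_TW (↥(maximalRealSubfield L)) a) (isUnit_det_realDiagonal L dV hdV hdV0)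
              (isUnit_det_TW (↥(maximalRealSubfield L)) a) (realDiagonal_map L dV hdV).symm (JW_eq (↥(maximalRealSubfield L)) L a)
              (isCompatible_chiSplittingLine L e₁ dV hdV hdV0 (toHeckeCharacter L lam) (isUnitary_toHeckeCharacter L lam)
                ((isOscillatorChar_toHeckeCharacter_iff lam).mpr hlam)
                (TW (↥(maximalRealSubfield L)) a) (isSymm_TW (↥(maximalRealSubfield L)) a)
                (isUnit_det_TW (↥(maximalRealSubfield L)) a) (JW (↥(maximalRealSubfield L)) L a)
                (JW_eq (↥(maximalRealSubfield L)) L a)))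
            (lineChar (↥(maximalRealSubfield L)) L (IsCMField.complexConj L) a χf),
      ∀ k x, T (rhoVAtLine (↥(maximalRealSubfield L)) L (IsCMField.complexConj L) 2 e₁ (Matrix.diagonal dV)
            (complexConj_imagUnit L) (imagUnit_ne_zero L) (imagUnit_mul_self L) (realDiagonal_isSymm L dV hdV)
            (isUnit_det_realDiagonal L dV hdV hdV0) (realDiagonal_map L dV hdV).symm
            (fun a => isCompatible_chiSplittingLine L e₁ dV hdV hdV0 (toHeckeCharacter L lam') (isUnitary_toHeckeCharacter L lam')
              ((isOscillatorChar_toHeckeCharacter_iff lam').mpr hlam')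
              (TW (↥(maximalRealSubfield L)) a) (isSymm_TW (↥(maximalRealSubfield L)) a)
              (isUnit_det_TW (↥(maximalRealSubfield L)) a) (JW (↥(maximalRealSubfield L)) L a)
              (JW_eq (↥(maximalRealSubfield L)) L a)) a χ k x) =
        ((α (UnitaryGroup.adelicDet (↥(maximalRealSubfield L)) L (IsCMField.complexConj L) 2 (Matrix.diagonal dV) hJdet
              (UnitaryGroup.finAdelicToAdelic (↥(maximalRealSubfield L)) L (IsCMField.complexConj L) 2 (Matrix.diagonal dV) k)) : ℂˣ) : ℂ) •
          weilCoinv (↥(maximalRealSubfield L)) L (IsCMField.complexConj L) 2 1 e₁ (Matrix.diagonal dV)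
            (JW (↥(maximalRealSubfield L)) L a) (complexConj_imagUnit L) (imagUnit_ne_zero L) (imagUnit_mul_self L)
            (realDiagonal_isSymm L dV hdV) (isSymm_TW (↥(maximalRealSubfield L)) a) (isUnit_det_realDiagonal L dV hdV hdV0)
            (isUnit_det_TW (↥(maximalRealSubfield L)) a) (realDiagonal_map L dV hdV).symm (JW_eq (↥(maximalRealSubfield L)) L a)
            (lineChar (↥(maximalRealSubfield L)) L (IsCMField.complexConj L) a χf)
            (isCompatible_chiSplittingLine L e₁ dV hdV hdV0 (toHeckeCharacter L lam) (isUnitary_toHeckeCharacter L lam)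
              ((isOscillatorChar_toHeckeCharacter_iff lam).mpr hlam)
              (TW (↥(maximalRealSubfield L)) a) (isSymm_TW (↥(maximalRealSubfield L)) a)
              (isUnit_det_TW (↥(maximalRealSubfield L)) a) (JW (↥(maximalRealSubfield L)) L a)
              (JW_eq (↥(maximalRealSubfield L)) L a))
            k (T x)
    := by
  intro L _ _ _ dV hdV hdV0 hJdet hcc n' e₁ lam hlam χ lam' hlam' hH α hα χf hχf a
  -- the three side conditions of the twist datum (★ §1) and (T1)
  have hc : Continuous α := continuous_alpha lam χ α hα
  have hrat : ∀ u : UnitaryGroup.adelicOne (↥(maximalRealSubfield L)) L (IsCMField.complexConj L),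
      (u : ideleGroup L) ∈ principalIdeles L → α u = 1 := alpha_eq_one_of_mem_principalIdeles lam χ α hα
  have hαu : ∀ u, ‖((α u : ℂˣ) : ℂ)‖ = 1 := norm_alpha lam χ α hα
  have hΛ : toHeckeCharacter L lam' = toHeckeCharacter L lam * ratioHecke L α hc hrat :=
    hH.trans (toHeckeCharacter_galConj_mul_checkOfChi_eq_mul_ratioHecke lam χ α hα hcc hc hrat)
  -- (T2) the splitting at the line `⟨a⟩` attached to `λ′` IS the `α ∘ det`-twist of the one attached to `λ`
  have hs_eq :
      chiSplittingLine L e₁ dV hdV hdV0 (toHeckeCharacter L lam') (isUnitary_toHeckeCharacter L lam')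
          ((isOscillatorChar_toHeckeCharacter_iff lam').mpr hlam') (TW (↥(maximalRealSubfield L)) a)
          (isUnit_det_TW (↥(maximalRealSubfield L)) a) (JW (↥(maximalRealSubfield L)) L a) (JW_eq (↥(maximalRealSubfield L)) L a) =
        adelicMpCont.twist (↥(maximalRealSubfield L)) (Fin n')
          (adelicGram (↥(maximalRealSubfield L)) e₁ (realDiagonal L dV hdV) (TW (↥(maximalRealSubfield L)) a))
          (chiSplittingLine L e₁ dV hdV hdV0 (toHeckeCharacter L lam) (isUnitary_toHeckeCharacter L lam)
            ((isOscillatorChar_toHeckeCharacter_iff lam).mpr hlam) (TW (↥(maximalRealSubfield L)) a)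
            (isUnit_det_TW (↥(maximalRealSubfield L)) a) (JW (↥(maximalRealSubfield L)) L a) (JW_eq (↥(maximalRealSubfield L)) L a))
          (α.comp (pairDet (↥(maximalRealSubfield L)) L (IsCMField.complexConj L) 2 1 e₁ (Matrix.diagonal dV)
            (JW (↥(maximalRealSubfield L)) L a)
            (det_reindex_kronecker_diagonal_line_ne_zero L e₁ dV hdV0 (TW (↥(maximalRealSubfield L)) a)
              (isUnit_det_TW (↥(maximalRealSubfield L)) a) (JW (↥(maximalRealSubfield L)) L a) (JW_eq (↥(maximalRealSubfield L)) L a)))) :=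
    (chiSplittingLine_congr L e₁ dV hdV hdV0 hΛ (isUnitary_toHeckeCharacter L lam') ((isOscillatorChar_toHeckeCharacter_iff lam').mpr hlam')
        (isUnitary_mul_ratioHecke L (isUnitary_toHeckeCharacter L lam) hc hrat hαu)
        ((isSplittingChar_mul_ratioHecke_iff L 1 (toHeckeCharacter L lam) hc hrat).2 ((isOscillatorChar_toHeckeCharacter_iff lam).mpr hlam))
        (TW (↥(maximalRealSubfield L)) a) (isUnit_det_TW (↥(maximalRealSubfield L)) a) (JW (↥(maximalRealSubfield L)) L a)
        (JW_eq (↥(maximalRealSubfield L)) L a)).trans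
      (chiSplittingLine_mul_ratioHecke L e₁ dV hdV hdV0 (toHeckeCharacter L lam) (isUnitary_toHeckeCharacter L lam)
        ((isOscillatorChar_toHeckeCharacter_iff lam).mpr hlam) hc hrat hαu (TW (↥(maximalRealSubfield L)) a)
        (isUnit_det_TW (↥(maximalRealSubfield L)) a) (JW (↥(maximalRealSubfield L)) L a) (JW_eq (↥(maximalRealSubfield L)) L a))
  -- the two compatibility proofs at the line `⟨a⟩`
  have hs₁ := isCompatible_chiSplittingLine L e₁ dV hdV hdV0 (toHeckeCharacter L lam') (isUnitary_toHeckeCharacter L lam')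
    ((isOscillatorChar_toHeckeCharacter_iff lam').mpr hlam') (TW (↥(maximalRealSubfield L)) a) (isSymm_TW (↥(maximalRealSubfield L)) a)
    (isUnit_det_TW (↥(maximalRealSubfield L)) a) (JW (↥(maximalRealSubfield L)) L a) (JW_eq (↥(maximalRealSubfield L)) L a)
  have hs := isCompatible_chiSplittingLine L e₁ dV hdV hdV0 (toHeckeCharacter L lam) (isUnitary_toHeckeCharacter L lam)
    ((isOscillatorChar_toHeckeCharacter_iff lam).mpr hlam) (TW (↥(maximalRealSubfield L)) a) (isSymm_TW (↥(maximalRealSubfield L)) a)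
    (isUnit_det_TW (↥(maximalRealSubfield L)) a) (JW (↥(maximalRealSubfield L)) L a) (JW_eq (↥(maximalRealSubfield L)) L a)
  have hs₂ : (splittingDatum (↥(maximalRealSubfield L)) L (IsCMField.complexConj L) 2 1 e₁ (Matrix.diagonal dV)
      (JW (↥(maximalRealSubfield L)) L a) (complexConj_imagUnit L) (imagUnit_ne_zero L) (imagUnit_mul_self L) (realDiagonal_isSymm L dV hdV)
      (isSymm_TW (↥(maximalRealSubfield L)) a) (isUnit_det_realDiagonal L dV hdV hdV0) (isUnit_det_TW (↥(maximalRealSubfield L)) a)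
      (realDiagonal_map L dV hdV).symm (JW_eq (↥(maximalRealSubfield L)) L a)).IsCompatible
      (adelicMpCont.twist (↥(maximalRealSubfield L)) (Fin n')
        (adelicGram (↥(maximalRealSubfield L)) e₁ (realDiagonal L dV hdV) (TW (↥(maximalRealSubfield L)) a))
        (chiSplittingLine L e₁ dV hdV hdV0 (toHeckeCharacter L lam) (isUnitary_toHeckeCharacter L lam)
          ((isOscillatorChar_toHeckeCharacter_iff lam).mpr hlam) (TW (↥(maximalRealSubfield L)) a)
          (isUnit_det_TW (↥(maximalRealSubfield L)) a) (JW (↥(maximalRealSubfield L)) L a) (JW_eq (↥(maximalRealSubfield L)) L a))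
        (α.comp (pairDet (↥(maximalRealSubfield L)) L (IsCMField.complexConj L) 2 1 e₁ (Matrix.diagonal dV)
          (JW (↥(maximalRealSubfield L)) L a)
          (det_reindex_kronecker_diagonal_line_ne_zero L e₁ dV hdV0 (TW (↥(maximalRealSubfield L)) a)
            (isUnit_det_TW (↥(maximalRealSubfield L)) a) (JW (↥(maximalRealSubfield L)) L a) (JW_eq (↥(maximalRealSubfield L)) L a))))) :=
    hs_eq ▸ hs₁
  -- (T3) transport along the equality of splittings
  obtain ⟨T₃, hT₃⟩ := exists_coinvEquiv_of_splitting_eq (↥(maximalRealSubfield L)) L (IsCMField.complexConj L) 2 1 e₁ (Matrix.diagonal dV)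
    (JW (↥(maximalRealSubfield L)) L a) (complexConj_imagUnit L) (imagUnit_ne_zero L) (imagUnit_mul_self L) (realDiagonal_isSymm L dV hdV)
    (isSymm_TW (↥(maximalRealSubfield L)) a) (isUnit_det_realDiagonal L dV hdV hdV0) (isUnit_det_TW (↥(maximalRealSubfield L)) a)
    (realDiagonal_map L dV hdV).symm (JW_eq (↥(maximalRealSubfield L)) L a) hs_eq hs₁ hs₂ (lineChar (↥(maximalRealSubfield L)) L (IsCMField.complexConj L) a χ.1)
  -- (T4) the W-side characters: `χ_W = ĉ_W · χf_W` on `U(⟨a⟩)(𝔸_f) = u·1_W`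
  have hχ' : ∀ u : UnitaryGroup.finAdelic (↥(maximalRealSubfield L)) L (IsCMField.complexConj L) 1 (JW (↥(maximalRealSubfield L)) L a),
      lineChar (↥(maximalRealSubfield L)) L (IsCMField.complexConj L) a χ.1 u =
        twistCharW (↥(maximalRealSubfield L)) L (IsCMField.complexConj L) 2 1 (Matrix.diagonal dV) (JW (↥(maximalRealSubfield L)) L a)
            (α.comp (pairDet (↥(maximalRealSubfield L)) L (IsCMField.complexConj L) 2 1 e₁ (Matrix.diagonal dV)
              (JW (↥(maximalRealSubfield L)) L a)
              (det_reindex_kronecker_diagonal_line_ne_zero L e₁ dV hdV0 (TW (↥(maximalRealSubfield L)) a)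
                (isUnit_det_TW (↥(maximalRealSubfield L)) a) (JW (↥(maximalRealSubfield L)) L a) (JW_eq (↥(maximalRealSubfield L)) L a)))) u *
          lineChar (↥(maximalRealSubfield L)) L (IsCMField.complexConj L) a χf u := by
    intro u
    obtain ⟨v, rfl⟩ := (lineCenterEquiv (↥(maximalRealSubfield L)) L (IsCMField.complexConj L) a).surjective u
    rw [lineCenterEquiv_apply, lineChar_finAdelicCenter, lineChar_finAdelicCenter,
      twistCharW_comp_pairDet_finAdelicCenter (↥(maximalRealSubfield L)) L (IsCMField.complexConj L) 2 e₁ (Matrix.diagonal dV)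
        (JW (↥(maximalRealSubfield L)) L a) _ hJdet α v, hχf v, mul_left_comm, mul_inv_cancel, mul_one]
  refine ⟨T₃.trans (weilCoinvTwistEquiv (↥(maximalRealSubfield L)) L (IsCMField.complexConj L) 2 1 e₁ (Matrix.diagonal dV)
      (JW (↥(maximalRealSubfield L)) L a) (complexConj_imagUnit L) (imagUnit_ne_zero L) (imagUnit_mul_self L) (realDiagonal_isSymm L dV hdV)
      (isSymm_TW (↥(maximalRealSubfield L)) a) (isUnit_det_realDiagonal L dV hdV hdV0) (isUnit_det_TW (↥(maximalRealSubfield L)) a)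
      (realDiagonal_map L dV hdV).symm (JW_eq (↥(maximalRealSubfield L)) L a) _ hs hs₂ hχ'), fun k x => ?_⟩
  rw [LinearEquiv.trans_apply, LinearEquiv.trans_apply, rhoVAtLine, hT₃, weilCoinvTwistEquiv_weilCoinv,
    twistCharV_comp_pairDet (↥(maximalRealSubfield L)) L (IsCMField.complexConj L) 2 e₁ (Matrix.diagonal dV)
      (JW (↥(maximalRealSubfield L)) L a) _ hJdet α k]

end Summit.HodgeConjecture.HodgeConjecture.Cruxes.HLiu418.F0P5CurveThetaCompanionDetTwist

end
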